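import Summits.AtomisticToContinuum.HydrodynamicLimit.Theorems.OneFlightGossipEngineEnergyCurrentTailsPedigreeObjects
import Summits.AtomisticToContinuum.HydrodynamicLimit.Theorems.OneFlightGossipEngineEnergyCurrentTailsPedigreeKinematics
import Literature.MathematicalPhysics.KineticTheory.CollisionTubePullbackFlight
import HarnessLib

/-!
# Sure kinematics of the backward energy lineage (line `pedigree-perpetuity`,
# crux `EnergyCurrentTails`, stmt-AtomisticToContinuum-9235)

Support file (`--supports stmt-AtomisticToContinuum-9235`) for the registered stub
`stub_lineageLedgerSure : LineageLedgerSure` (lead seat c3) over the vocabulary file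
`…Theorems.OneFlightGossipEngineEnergyCurrentTailsPedigreeObjects` (`lineage`, `carrier`, `ltime`,
`brecord`, `Genuine`, `energy`, `projEnergy`, `quantum`, `share`, `weight`, `termIndex`, …).
Everything here is deterministic bookkeeping of ONE hard-sphere trajectory on the flat torus; no
probability, and NO smallness of the diameter `ε` is used:

* §A torus trajectories: contact is symmetric in the pair; at an ordered contact pair of a trajectory
  the diameter is positive and the minimal-image separation is ANTISYMMETRIC (both orders are contact
  pairs, the common left limit is incoming for both and both elastic laws give the same value — this
  pins the two impact lines together with opposite orientations); velocities of a non-colliding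
  particle (and their left limits) along the trajectory;
* §B unfolding lemmas of the lineage (`ltime_succ`, `carrier_succ`, …) and clause (K0): every share
  lies in `[0, 1]` (Cauchy–Schwarz with an impact vector of norm `≤ 1`; any curve);
* §C along a trajectory: `0 ≤ τ_{n+1} ≤ τ_n ≤ s`, genuine transitions are collisions of the carrier,
  genuineness is downward closed and fails eventually, the terminal flight starts at time `0`
  (terminal energy = seed's energy at time `0`), `E_0 = ‖v_i(s)‖²` off collisions, the energy cap by
  conservation of the total kinetic energy, and clause (K) (`genuine_kinematics`, the registered
  helper `lineageGenuine_kinematics` of this file): packet step, pair bound, identification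
  `E_{n+1} = E^{proj}_n` (recorded pre-velocities are left limits = flight-start velocities) and time
  decrease.

The heir cascade (clause C) and the assembly of the stub are in `…PedigreeLedgerSure`.
References: Gallagher–Saint-Raymond–Texier 2013 §4.1; Cercignani–Illner–Pulvirenti 1994 §4.2.
-/

noncomputable section

open Set Filter
open scoped InnerProductSpace BigOperators Topology

namespace Summit.AtomisticToContinuum.HydrodynamicLimit.Theorems.EnergyCurrentTailsPedigree

open Literature.MathematicalPhysics.KineticTheory Literature.Analysis.FluidPDE

/-! ## §A Torus trajectories: contact symmetry, positivity of `ε`, antisymmetry of the separation -/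

section TorusTrajectory

variable {d : Type*} [Fintype d] {N : ℕ} {ε : ℝ}

/-- Contact is symmetric in the pair on the torus (the minimal-image distance is symmetric). -/
theorem torus_mem_contactSet_comm {i j : Fin N} {z : Config N d (UnitAddTorus d)} :
    z ∈ contactSet (Torus.geometry d) N ε i j ↔ z ∈ contactSet (Torus.geometry d) N ε j i := by
  simp only [mem_contactSet, Torus.norm_geometry_sepVec, Torus.euclidDist_comm (z i).1]

/-- On the torus `(j, i)` is an ordered contact pair iff `(i, j)` is (no regularity needed). -/
theorem torus_swap_mem_contactPairs {z : Config N d (UnitAddTorus d)} {i j : Fin N} :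
    (j, i) ∈ contactPairs (Torus.geometry d) ε z ↔ (i, j) ∈ contactPairs (Torus.geometry d) ε z := by
  rw [mem_contactPairs, mem_contactPairs, ne_comm, torus_mem_contactSet_comm]

/-- On the torus a participating particle and its partner form an ORDERED contact pair. -/
theorem torus_mk_partner_mem_contactPairs {z : Config N d (UnitAddTorus d)} {i : Fin N}
    (hi : Participates (Torus.geometry d) ε z i) :
    (i, partner (Torus.geometry d) ε z i) ∈ contactPairs (Torus.geometry d) ε z := by
  rcases collide_partner hi with h | h
  · exact h
  · exact torus_swap_mem_contactPairs.1 h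

/-- At an ordered contact pair of a hard-sphere trajectory the diameter is positive: the left limit is
incoming, so the separation vector (of norm `ε`) is nonzero. -/
theorem pos_of_mem_contactPairs {X : Type*} [TopologicalSpace X] {G : Geometry d X}
    {γ : ℝ → Config N d X} (h : IsHardSphereTrajectory G ε N γ) {t : ℝ} {i j : Fin N}
    (hp : (i, j) ∈ contactPairs G ε (γ t)) : 0 < ε := by
  obtain ⟨hij, hc⟩ := mem_contactPairs.1 hp
  have hin := h.isIncoming_collidePair hij hc
  have hn : G.sepVec (γ t i).1 (γ t j).1 ≠ 0 := by
    intro h0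
    simp only [IsIncoming, collidePair_apply_fst, h0, inner_zero_left, lt_self_iff_false] at hin
  rw [← (mem_contactSet.1 hc).2]
  exact norm_pos_iff.2 hn

/-- **Antisymmetry of the separation at a collision.**  At an ordered contact pair `(i, j)` of a
hard-sphere trajectory on the torus (ANY diameter), `sepVec x_j x_i = - sepVec x_i x_j`: both orders
are contact pairs, the common left limit `w` is incoming for both, and `collidePair i j w = γ t =
collidePair j i w`; comparing the velocity of `i` gives `b • n' = -(a • n)` with `a, b < 0`, whence
`a = b` (norms) and `n' = -n`. -/
theorem sepVec_swap_of_mem_contactPairs {γ : ℝ → Config N d (UnitAddTorus d)}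
    (h : IsHardSphereTrajectory (Torus.geometry d) ε N γ) {t : ℝ} {i j : Fin N}
    (hp : (i, j) ∈ contactPairs (Torus.geometry d) ε (γ t)) :
    (Torus.geometry d).sepVec (γ t j).1 (γ t i).1 = -(Torus.geometry d).sepVec (γ t i).1 (γ t j).1 := by
  obtain ⟨hij, hc⟩ := mem_contactPairs.1 hp
  have hc' : γ t ∈ contactSet (Torus.geometry d) N ε j i := torus_mem_contactSet_comm.1 hc
  have hε : 0 < ε := pos_of_mem_contactPairs h hp
  have hw' : collidePair (Torus.geometry d) j i (γ t) = collidePair (Torus.geometry d) i j (γ t) := by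
    rw [← h.leftLim_eq_collidePair hij.symm hc', h.leftLim_eq_collidePair hij hc]
  have hin : IsIncoming (Torus.geometry d) (collidePair (Torus.geometry d) i j (γ t)) i j :=
    h.isIncoming_collidePair hij hc
  have hin' : IsIncoming (Torus.geometry d) (collidePair (Torus.geometry d) i j (γ t)) j i := by
    rw [← hw']
    exact h.isIncoming_collidePair hij.symm hc'
  have heq : collidePair (Torus.geometry d) i j (collidePair (Torus.geometry d) i j (γ t))
      = collidePair (Torus.geometry d) j i (collidePair (Torus.geometry d) i j (γ t)) := by
    conv_rhs => rw [← hw']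
    rw [collidePair_collidePair hij, collidePair_collidePair hij.symm]
  set w := collidePair (Torus.geometry d) i j (γ t) with hw
  set n := (Torus.geometry d).sepVec (γ t i).1 (γ t j).1 with hn
  set n' := (Torus.geometry d).sepVec (γ t j).1 (γ t i).1 with hn'
  have hwi : (w i).1 = (γ t i).1 := collidePair_apply_fst (γ t) i
  have hwj : (w j).1 = (γ t j).1 := collidePair_apply_fst (γ t) j
  have hnn : ‖n‖ = ε := (mem_contactSet.1 hc).2
  have hnn' : ‖n'‖ = ε := (mem_contactSet.1 hc').2
  have hi := congrArg (fun z : Config N d (UnitAddTorus d) => (z i).2) heq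
  simp only [collidePair_apply_left hij, collidePair_apply_right, hwi, hwj, reflectVel] at hi
  rw [← hn, ← hn'] at hi
  set a := ⟪(w i).2 - (w j).2, n⟫_ℝ / ‖n‖ ^ 2 with ha
  set b := ⟪(w j).2 - (w i).2, n'⟫_ℝ / ‖n'‖ ^ 2 with hb
  have hε2 : 0 < ε ^ 2 := by positivity
  have ha0 : a < 0 := by
    rw [ha, hnn, real_inner_comm]
    refine div_neg_of_neg_of_pos ?_ hε2
    have := hin
    simp only [IsIncoming, hwi, hwj] at this
    exact this
  have hb0 : b < 0 := by
    rw [hb, hnn', real_inner_comm]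
    refine div_neg_of_neg_of_pos ?_ hε2
    have := hin'
    simp only [IsIncoming, hwi, hwj] at this
    exact this
  have h1 : b • n' = -(a • n) := by
    rw [sub_eq_add_neg] at hi
    exact (add_left_cancel hi).symm
  have hab : a = b := by
    have h2 := congrArg (fun v : EuclideanSpace ℝ d => ‖v‖) h1
    simp only [norm_neg, norm_smul, Real.norm_eq_abs, hnn, hnn'] at h2
    have h3 : |b| = |a| := mul_right_cancel₀ hε.ne' h2
    rw [abs_of_neg ha0, abs_of_neg hb0] at h3
    linarith
  rw [hab, ← smul_neg] at h1
  exact smul_right_injective _ hb0.ne h1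

/-- A particle with no collision during `(a, b]` keeps its velocity (torus trajectory). -/
theorem vel_eq_of_forall_not_participates {γ : ℝ → Config N d (UnitAddTorus d)}
    (h : IsHardSphereTrajectory (Torus.geometry d) ε N γ) (k : Fin N) {a b : ℝ} (hab : a ≤ b)
    (hk : ∀ u ∈ Ioc a b, ¬ Participates (Torus.geometry d) ε (γ u) k) : (γ b k).2 = (γ a k).2 := by
  rw [apply_eq_translate_of_forall_not_participates h Torus.continuous_geometry_translate k hab hk]

/-- The left-limit velocity at `b` of a particle with no collision in `(a, b)` is its velocity at `a`
(torus trajectory, `a < b`). -/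
theorem leftLim_vel_eq_of_forall_not_participates {γ : ℝ → Config N d (UnitAddTorus d)}
    (h : IsHardSphereTrajectory (Torus.geometry d) ε N γ) (k : Fin N) {a b : ℝ} (hab : a < b)
    (hk : ∀ u ∈ Ioo a b, ¬ Participates (Torus.geometry d) ε (γ u) k) :
    (Function.leftLim γ b k).2 = (γ a k).2 := by
  have hev : Continuous fun ζ : Config N d (UnitAddTorus d) => (ζ k).2 := (continuous_apply k).snd
  have h1 : Tendsto (fun u => (γ u k).2) (𝓝[<] b) (𝓝 (Function.leftLim γ b k).2) :=
    (hev.tendsto _).comp (h.tendsto_leftLim Torus.continuous_geometry_translate b)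
  have h2 : Tendsto (fun u => (γ u k).2) (𝓝[<] b) (𝓝 (γ a k).2) := by
    refine tendsto_const_nhds.congr' ?_
    filter_upwards [Ioo_mem_nhdsLT hab] with u hu
    exact (vel_eq_of_forall_not_participates h k hu.1.le fun r hr =>
      hk r ⟨hr.1, lt_of_le_of_lt hr.2 hu.2⟩).symm
  exact tendsto_nhds_unique h1 h2

end TorusTrajectory

/-! ## §B Unfolding the lineage; shares lie in `[0, 1]` (clause K0, any curve) -/

section Unfold

variable {N : ℕ} (ε : ℝ) (γ : ℝ → Config N (Fin 3) T3) (i : Fin N) (s : ℝ)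

/-- The lineage starts at the tagged particle. -/
@[simp]
theorem carrier_zero : carrier ε γ i s 0 = i := rfl

/-- Time recursion: `τ_{n+1}` is the start of the carrier's flight current before `τ_n`. -/
theorem ltime_succ (n : ℕ) :
    ltime ε γ i s (n + 1)
      = flightStart (Torus.geometry (Fin 3)) ε γ 0 (carrier ε γ i s n) (ltime ε γ i s n) := rfl

/-- Carrier recursion (the tie rule of `stepBack`): the next carrier is the projectile of the record
behind state `n` — the carrier itself if its pre-speed is at least the partner's, else the partner. -/
theorem carrier_succ (n : ℕ) :
    carrier ε γ i s (n + 1)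
      = if ‖(brecord ε γ i s n).preVel.2‖ ≤ ‖(brecord ε γ i s n).preVel.1‖ then carrier ε γ i s n
        else partner (Torus.geometry (Fin 3)) ε (γ (ltime ε γ i s (n + 1))) (carrier ε γ i s n) :=
  rfl

/-- The carried energy is the squared speed of the carrier at the start of its flight. -/
theorem energy_eq (n : ℕ) :
    energy ε γ i s n = ‖(γ (ltime ε γ i s (n + 1)) (carrier ε γ i s n)).2‖ ^ 2 := rfl

/-- `w_0 = 1`. -/
@[simp]
theorem weight_zero : weight ε γ i s 0 = 1 := by
  simp [weight]

/-- `w_{n+1} = w_n s_n`. -/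
theorem weight_succ (n : ℕ) : weight ε γ i s (n + 1) = weight ε γ i s n * share ε γ i s n :=
  Finset.prod_range_succ _ _

/-- The impact vector of the record `(c, partner c)` read off ANY configuration has norm `≤ 1`: at a
contact it is a unit vector (or `0` if `ε = 0`), and a non-participating particle is its own partner
(`sepVec x x = 0`). -/
theorem norm_impactVec_ofConfig_partner_le_one (ε : ℝ) (ζ : Config N (Fin 3) T3) (t : ℝ) (c : Fin N) :
    ‖(HardSphereCollisionRecord.ofConfig (Torus.geometry (Fin 3)) ε ζ t c
      (partner (Torus.geometry (Fin 3)) ε ζ c)).impactVec‖ ≤ 1 := by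
  rw [HardSphereCollisionRecord.ofConfig_impactVec]
  by_cases hpart : Participates (Torus.geometry (Fin 3)) ε ζ c
  · obtain ⟨-, hc⟩ := mem_contactPairs.1 (torus_mk_partner_mem_contactPairs hpart)
    have hnorm := (mem_contactSet.1 hc).2
    rw [norm_smul, norm_inv, Real.norm_eq_abs, hnorm]
    by_cases hε : ε = 0
    · simp [hε]
    · rw [abs_of_nonneg (hnorm ▸ norm_nonneg _), inv_mul_cancel₀ hε]
  · rw [partner_of_not_participates hpart, Torus.geometry_sepVec, sub_self, Torus.reprSym_zero, smul_zero,
      norm_zero]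
    exact zero_le_one

/-- In particular for the record behind every lineage state. -/
theorem norm_impactVec_brecord_le_one (n : ℕ) : ‖(brecord ε γ i s n).impactVec‖ ≤ 1 :=
  norm_impactVec_ofConfig_partner_le_one ε _ _ _

/-- `cos² ∈ [0, 1]`: for `‖ω‖ ≤ 1`, `0 ≤ ⟪v, ω⟫² / ‖v‖² ≤ 1` (Cauchy–Schwarz; the junk value at
`v = 0` is `0`). -/
theorem inner_sq_div_mem {ω : V3} (hω : ‖ω‖ ≤ 1) (v : V3) :
    0 ≤ ⟪v, ω⟫_ℝ ^ 2 / ‖v‖ ^ 2 ∧ ⟪v, ω⟫_ℝ ^ 2 / ‖v‖ ^ 2 ≤ 1 := by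
  refine ⟨div_nonneg (sq_nonneg _) (sq_nonneg _), div_le_one_of_le₀ ?_ (sq_nonneg _)⟩
  have h1 : |⟪v, ω⟫_ℝ| ≤ ‖v‖ :=
    (abs_real_inner_le_norm v ω).trans (mul_le_of_le_one_right (norm_nonneg _) hω)
  rw [← sq_abs]
  exact pow_le_pow_left₀ (abs_nonneg _) h1 2

/-- **Clause (K0).**  Every share lies in `[0, 1]` (genuine or not, any curve, any diameter). -/
theorem share_mem (n : ℕ) : 0 ≤ share ε γ i s n ∧ share ε γ i s n ≤ 1 := by
  have hω := norm_impactVec_brecord_le_one ε γ i s n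
  rw [share]
  split_ifs
  · have h := inner_sq_div_mem hω (brecord ε γ i s n).preVel.1
    constructor <;> linarith [h.1, h.2]
  · exact inner_sq_div_mem hω (brecord ε γ i s n).preVel.2

/-- Registered ∀-form of clause (K0) (helper of `stub_lineageLedgerSure`; the main theorem of this
file for the ledger). -/
theorem lineageShare_mem : ∀ {N : ℕ} (ε : ℝ) (γ : ℝ → Config N (Fin 3) T3) (i : Fin N) (s : ℝ) (n : ℕ), 0 ≤ share ε γ i s n ∧ share ε γ i s n ≤ 1 :=
  fun ε γ i s n => share_mem ε γ i s n

/-- Weights are nonnegative. -/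
theorem weight_nonneg (n : ℕ) : 0 ≤ weight ε γ i s n :=
  Finset.prod_nonneg fun j _ => (share_mem ε γ i s j).1

end Unfold

/-! ## §C Along a hard-sphere trajectory: times, genuine transitions (clause K), terminal data -/

section Trajectory

variable {N : ℕ} {ε : ℝ} {γ : ℝ → Config N (Fin 3) T3}

/-- Flight starts from time `0` are nonnegative: `0 ≤ τ_{n+1}`. -/
theorem ltime_succ_nonneg (h : IsHardSphereTrajectory (Torus.geometry (Fin 3)) ε N γ) (i : Fin N)
    (s : ℝ) (n : ℕ) : 0 ≤ ltime ε γ i s (n + 1) := by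
  rw [ltime_succ]
  exact le_flightStart (h.finite_collisionTimesOf_inter_Ioo _ 0 _)

/-- Times do not increase along the lineage (from a positive time `s`). -/
theorem ltime_succ_le (h : IsHardSphereTrajectory (Torus.geometry (Fin 3)) ε N γ) (i : Fin N)
    {s : ℝ} (hs : 0 < s) (n : ℕ) : ltime ε γ i s (n + 1) ≤ ltime ε γ i s n := by
  have h0 : 0 ≤ ltime ε γ i s n := by
    cases n with
    | zero => exact hs.le
    | succ m => exact ltime_succ_nonneg h i s m
  rw [ltime_succ]
  rcases mem_insert_iff.1 (h.flightStart_mem 0 (carrier ε γ i s n) (ltime ε γ i s n)) with h1 | h1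
  · rw [h1]
    exact h0
  · exact h1.2.2.le

/-- All lineage times are at most `s`. -/
theorem ltime_le (h : IsHardSphereTrajectory (Torus.geometry (Fin 3)) ε N γ) (i : Fin N) {s : ℝ}
    (hs : 0 < s) (n : ℕ) : ltime ε γ i s n ≤ s := by
  induction n with
  | zero => exact le_rfl
  | succ m ih => exact (ltime_succ_le h i hs m).trans ih

/-- A genuine transition happens at a collision time of the carrier, strictly before the state's
time. -/
theorem genuine_spec (h : IsHardSphereTrajectory (Torus.geometry (Fin 3)) ε N γ) (i : Fin N)
    {s : ℝ} {n : ℕ} (hg : Genuine ε γ i s n) :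
    ltime ε γ i s (n + 1) ∈ collisionTimesOf (Torus.geometry (Fin 3)) ε γ (carrier ε γ i s n)
      ∧ ltime ε γ i s (n + 1) < ltime ε γ i s n := by
  have hm := h.flightStart_mem 0 (carrier ε γ i s n) (ltime ε γ i s n)
  rw [← ltime_succ] at hm
  rcases mem_insert_iff.1 hm with h1 | h1
  · exact absurd h1 hg.ne'
  · exact ⟨h1.1, h1.2.2⟩

/-- Genuineness is downward closed: after a non-genuine transition (time `≤ 0`) the next flight
start is `sSup {0} = 0`. -/
theorem not_genuine_succ (i : Fin N) {s : ℝ} {n : ℕ} (hn : ¬ Genuine ε γ i s n) :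
    ¬ Genuine ε γ i s (n + 1) := by
  rw [Genuine, not_lt, ltime_succ, flightStart, Ioo_eq_empty hn, inter_empty, insert_empty_eq,
    csSup_singleton]

/-- Eventually the lineage reaches the data: some transition is not genuine (the genuine times are
strictly decreasing collision times in `[0, s]`, of which there are finitely many). -/
theorem exists_not_genuine (h : IsHardSphereTrajectory (Torus.geometry (Fin 3)) ε N γ) (i : Fin N)
    {s : ℝ} (hs : 0 < s) : ∃ K, ¬ Genuine ε γ i s K := by
  by_contra hall
  simp only [not_exists, not_not] at hall
  have hanti : StrictAnti fun n => ltime ε γ i s (n + 1) :=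
    strictAnti_nat_of_succ_lt fun n => (genuine_spec h i (hall (n + 1))).2
  have hmem : ∀ n, ltime ε γ i s (n + 1) ∈ collisionTimes (Torus.geometry (Fin 3)) ε γ ∩ Icc 0 s :=
    fun n => ⟨collisionTimesOf_subset γ _ (genuine_spec h i (hall n)).1, ltime_succ_nonneg h i s n,
      ltime_le h i hs (n + 1)⟩
  exact Set.infinite_of_injective_forall_mem hanti.injective hmem (h.locFinite 0 s)

/-- The terminal index is the first non-genuine transition. -/
theorem termIndex_spec (h : IsHardSphereTrajectory (Torus.geometry (Fin 3)) ε N γ) (i : Fin N)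
    {s : ℝ} (hs : 0 < s) :
    ¬ Genuine ε γ i s (termIndex ε γ i s) ∧ ∀ n, n < termIndex ε γ i s → Genuine ε γ i s n :=
  ⟨Nat.sInf_mem (exists_not_genuine h i hs), fun _ hn => not_not.1 (Nat.notMem_of_lt_sInf hn)⟩

/-- The terminal flight starts at time `0`. -/
theorem ltime_termIndex_succ (h : IsHardSphereTrajectory (Torus.geometry (Fin 3)) ε N γ) (i : Fin N)
    {s : ℝ} (hs : 0 < s) : ltime ε γ i s (termIndex ε γ i s + 1) = 0 :=
  le_antisymm (not_lt.1 (termIndex_spec h i hs).1) (ltime_succ_nonneg h i s _)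

/-- **Terminal energy** is the seed's energy at time `0`. -/
theorem energy_termIndex (h : IsHardSphereTrajectory (Torus.geometry (Fin 3)) ε N γ) (i : Fin N)
    {s : ℝ} (hs : 0 < s) :
    energy ε γ i s (termIndex ε γ i s) = ‖(γ 0 (termCarrier ε γ i s)).2‖ ^ 2 := by
  rw [energy_eq, ltime_termIndex_succ h i hs]
  rfl

/-- **`E_0`** is the current energy if `i` is not in a collision at time `s`. -/
theorem energy_zero_of_not_participates (h : IsHardSphereTrajectory (Torus.geometry (Fin 3)) ε N γ)
    (i : Fin N) {s : ℝ} (hs : 0 < s)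
    (hnp : ¬ Participates (Torus.geometry (Fin 3)) ε (γ s) i) :
    energy ε γ i s 0 = ‖(γ s i).2‖ ^ 2 := by
  rw [energy_eq, carrier_zero]
  have hlt : ltime ε γ i s 1 < s := flightStart_lt (h.finite_collisionTimesOf_inter_Ioo i 0 s) hs
  rw [vel_eq_of_forall_not_participates h i hlt.le fun u hu => ?_]
  rcases hu.2.lt_or_eq with hus | rfl
  · exact h.not_participates_of_mem_Ioo_flightStart (a := 0) (t := s) ⟨hu.1, hus⟩
  · exact hnp

/-- **Energy cap**: every carried energy is at most the (conserved) total `∑_l ‖v_l(0)‖²`. -/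
theorem energy_le_total (h : IsHardSphereTrajectory (Torus.geometry (Fin 3)) ε N γ) (i : Fin N)
    (s : ℝ) (n : ℕ) : energy ε γ i s n ≤ ∑ l, ‖(γ 0 l).2‖ ^ 2 := by
  rw [energy_eq]
  have hE := IsHardSphereTrajectory.configEnergy_eq_holds h (ltime ε γ i s (n + 1)) 0
  simp only [configEnergy] at hE
  rw [← mul_left_cancel₀ (inv_ne_zero two_ne_zero) hE]
  exact Finset.single_le_sum (f := fun l => ‖(γ (ltime ε γ i s (n + 1)) l).2‖ ^ 2)
    (fun l _ => sq_nonneg _) (Finset.mem_univ _)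

end Trajectory

end Summit.AtomisticToContinuum.HydrodynamicLimit.Theorems.EnergyCurrentTailsPedigree

end
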